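import Literature.NumberTheory.GaloisCohomology.Howard2004.DVRSettingEngineAssemblyFull
import Literature.NumberTheory.GaloisCohomology.Howard2004.DVRSettingEngineRhoProofs
import Literature.NumberTheory.GaloisCohomology.Howard2004.DVRSettingEngineLamProofs
import Literature.NumberTheory.GaloisCohomology.Howard2004.EngineDecompositionsOfSkewPairingFactProofs
import Literature.NumberTheory.GaloisCohomology.Howard2004.DVRKolyvaginBoundPrintIntended
import HarnessLib

/-!
# Howard 2004, Thm. 1.6.1 AS INTENDED BY ITS PRINTED PROOF (`thm161_dvrKolyvaginBound_printIntended`, F-161′) from the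
# engine inputs on FULL, TAME-PINNED settings: the F-161′ twins of the four F-161 wrappers (theorems only)

Topic `NumberTheory/GaloisCohomology/Howard2004` (sequel to `TameWLOGProofs` — «WLOG tame», `thm161_of_forall_tame` —,
`Thm161OfFullTowersProofs` — `conclusion_of_full_of_tame`, `thm161_of_full_tame` —, `DVRSettingEngineAssemblyFull` —
`conclusion_of_engineInputs_full`, `thm161_of_engineInputs_full` —, `DVRSettingEngineAssemblyResidual` —
`thm161_of_h159_hcheb`, `thm161_of_prop141_h159_hcheb` — and `DVRKolyvaginBoundPrintIntended` — the constant
`thm161_dvrKolyvaginBound_printIntended`, F-161′).  THEOREMS ONLY: no definition, no named fact, no instance, no notation,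
no `sorry`.

SOURCE / WHY.  B. Howard, *The Heegner point Kolyvagin system*, Compositio Math. **140** (2004) = arXiv:1202.6340,
Thm. 1.6.1 (arXiv Thm. 2.6.1, p. 11 L23–28) and its proof (p. 11 L33 – p. 12 L55).  The cell's engine discharges the
per-setting content of Thm. 1.6.1 under the two standing clauses its printed proof uses — `p ≠ 0` in the DVR `R`
(`hp0`, the key `𝓛_k ↔ R/𝔪^k`, REF-169 «HP0-STANDING») and `p ∤ #𝓞_K^×` (`hu`, §1.2's `p`-Sylow identification, REF-167) —
so its by-name target is F-161′ (`thm161_dvrKolyvaginBound_printIntended`, lit g45 p710086), NOT the print-as-worded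
F-161.  The four F-161 wrappers of the cell conclude `thm161_dvrKolyvaginBound` from per-setting hypotheses WITHOUT the
two guards; THIS FILE gives their F-161′ twins, whose per-setting hypotheses may USE the guards: the transports behind
the wrappers (the levelwise unit rescaling of «WLOG tame», the `π`-adic refinement `S.refine` and the cofinal transfer
`conclusion_of_refine`) keep `p`, `K`, `R` fixed, so the guards pass through them unchanged.  Proofs = the originals'
proofs with the two guards threaded (same tree lemmas, by name).

WHAT IS PROVED (all in `namespace DVRSetting`, binder lists = the originals' VERBATIM with
`((p : ℕ) : R) ≠ 0 → ¬ p ∣ Nat.card (𝓞 K)ˣ →` inserted immediately before `S.LargePrimes`):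
* §1 **`thm161_printIntended_of_forall_tame`** (twin of `thm161_of_forall_tame`);
* §2 **`thm161_printIntended_of_full_tame`** (twin of `thm161_of_full_tame`);
* §3 **`thm161_printIntended_of_engineInputs_full`** (twin of `thm161_of_engineInputs_full`);
* §4 **`thm161_printIntended_of_h159_hcheb`**, **`thm161_printIntended_of_prop141_h159_hcheb`** (twins of
  `thm161_of_h159_hcheb` / `thm161_of_prop141_h159_hcheb`): F-161′ from the print leaf C45.1′
  (`prop141_casselsTate_skewPairing_atLevel`) and — per full tame-pinned setting with H.0–H.5, `(p : R) ≠ 0`,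
  `p ∤ #𝓞_K^×`, `𝓛_s ⊂ 𝓛`, `κ_1 ≠ 0` — the two remaining engine inputs `h159` and `hchebI ∧ hchebII`.

Cell `pub/bsd-print-x9`, G87 = Howard Thm. 1.6.1 (print leaf `thm161_dvrKolyvaginBound`, `stub_h161` of
stmt-BirchSwinnertonDyer-22642); seat `bsd-line-x10b-p1` LEAD g13, brick (F161′-WRAPPERS).  HONEST FRAMING: neither
`thm161_dvrKolyvaginBound` nor `thm161_dvrKolyvaginBound_printIntended` is proved here (the per-setting inputs remain
hypotheses); no summit statement is proved; the Birch–Swinnerton-Dyer conjecture is not proved by any of this.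

References: [Howard2004HeegnerKolyvagin] Thm. 1.6.1, Rem. 1.3.1, Def. 1.1.8, Def. 1.2.3, Lemma 1.6.2, Lemma 1.6.4.
-/

set_option autoImplicit false

noncomputable section

open Function NumberField IsDedekindDomain Field
open scoped NumberField ContRepresentation Classical

namespace Literature.NumberTheory.GaloisCohomology.Howard2004

open Literature.NumberTheory.GaloisRepresentations
open Literature.NumberTheory.GaloisRepresentations.DiscreteGaloisModule
open Literature.NumberTheory.GaloisRepresentations.galoisCohomology
open Literature.NumberTheory.EllipticCurves

namespace DVRSetting

/-! ## §1 «WLOG tame» for F-161′ -/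

/-- **«WLOG tame» for F-161′**: Thm. 1.6.1-as-intended (`thm161_dvrKolyvaginBound_printIntended`) from its instance on
TAME-PINNED settings, where the per-setting hypothesis may use the two guards `(p : R) ≠ 0`, `p ∤ #𝓞_K^×`.  Proof = that
of `thm161_of_forall_tame` (pass to «`S` with the tame slots», rescale the Kolyvagin system levelwise by units, transfer
the conclusion back by `conclusion_with_fs_iff`) with the guards threaded — the tame modification keeps `p`, `K`, `R`.
[cite: Howard2004HeegnerKolyvagin, Thm. 1.6.1, Def. 1.1.8, Def. 1.2.3 (arXiv:1202.6340 Thm. 2.6.1 p. 11 L23–28; p. 5 L144–149; p. 7 L1–12)] -/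
theorem thm161_printIntended_of_forall_tame
    (h : ∀ (p : ℕ) [Fact p.Prime] (K : Type) [Field K] [NumberField K]
      (R : Type) [CommRing R] [IsDomain R] [IsDiscreteValuationRing R] [Algebra ℤ_[p] R]
      (N : ℕ → Type) [∀ k, AddCommGroup (N k)] [∀ k, TopologicalSpace (N k)]
      [∀ k, DiscreteTopology (N k)] [∀ k, Module R (N k)]
      (Rk : ℕ → Type) [∀ k, CommRing (Rk k)] [∀ k, IsLocalRing (Rk k)] [∀ k, TopologicalSpace (Rk k)]
      [∀ k, DiscreteTopology (Rk k)] [∀ k, Algebra ℤ_[p] (Rk k)] [∀ k, Algebra R (Rk k)]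
      [∀ k, Module (Rk k) (N k)] [∀ k, IsScalarTower R (Rk k) (N k)]
      (Nbar : Type) [AddCommGroup Nbar] [TopologicalSpace Nbar] [DiscreteTopology Nbar]
      [∀ k, Module (Rk k) Nbar]
      (Nq : ℕ → Finset (HeightOneSpectrum (𝓞 K)) → Type) [∀ k n, AddCommGroup (Nq k n)]
      [∀ k n, TopologicalSpace (Nq k n)] [∀ k n, DiscreteTopology (Nq k n)]
      [∀ k n, Module (Rk k) (Nq k n)] [∀ k n, Module R (Nq k n)]
      [∀ k n, IsScalarTower R (Rk k) (Nq k n)] [∀ k n, Finite (Nq k n)]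
      (S : DVRSetting p K R N Rk Nbar Nq) (κ : S.KolyvaginSystem) (hy : S.SatisfiesH)
      (pins : ∀ v : HeightOneSpectrum (𝓞 K), TamePin v)
      (hP : ∀ k n v, n ∈ levels S.L ∧ v ∈ n → TameHyp (S.LD k).ρq n v),
      (∀ k, (S.LD k).fs = tameSlotOn pins (S.LD k).ρq (fun n v => n ∈ levels S.L ∧ v ∈ n) (hP k)) →
      ((p : ℕ) : R) ≠ 0 → ¬ p ∣ Nat.card (𝓞 K)ˣ →
      S.LargePrimes → κ.one ≠ 0 → S.Conclusion hy κ.one) :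
    thm161_dvrKolyvaginBound_printIntended := by
  intro p _ K _ _ R _ _ _ _ N _ _ _ _ Rk _ _ _ _ _ _ _ _ Nbar _ _ _ _ Nq _ _ _ _ _ _ S κ hy hp0 hu hL hone
  haveI hfin : ∀ k n, Finite (Nq k n) := fun k n =>
    haveI := S.finite_level hy k
    Finite.of_surjective _ ((S.LD k).isQuotientBy n).surjective
  let pins : ∀ v : HeightOneSpectrum (𝓞 K), TamePin v := fun v => (nonempty_tamePin v).some
  have hP : ∀ k n v, n ∈ levels S.L ∧ v ∈ n → TameHyp (S.LD k).ρq n v := fun k =>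
    tameHyp_of_mem_levels_of_h0 (hy.h0 k) (S.LD k) (hy.primes_eq k)
  -- «S with the tame slots»
  let St : DVRSetting p K R N Rk Nbar Nq :=
    { S with LD := fun k => (S.LD k).withTameSlotOn pins (fun n v => n ∈ levels S.L ∧ v ∈ n) (hP k) }
  have hyt : St.SatisfiesH := S.satisfiesH_withTameSlotOn hy pins hP
  have htame : ∀ k, (St.LD k).fs = tameSlotOn pins (St.LD k).ρq (fun n v => n ∈ levels St.L ∧ v ∈ n) (hP k) :=
    fun _ => rfl
  -- the original slots as a second admissible family on `St`
  have h2adm : ∀ k, ({ St.LD k with fs := (S.LD k).fs } : LevelData (Rk k) (St.T.ρ k) (St.t k) (Nq k)).IsFsAdmissible :=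
    fun k => hy.fs_admissible k
  obtain ⟨u, w, hwu, hrel, hcompat⟩ := St.exists_levelwise_units hyt pins hP htame (fun k => (S.LD k).fs) h2adm
    hy.fs_natural
  obtain ⟨κt, hκone, -⟩ := St.exists_kolyvaginSystem_smul_of_isRescaledFs_levelwise hyt
    (fun k => hyt.isSelmerScalarStable k) (fun k n v _ hn => hyt.fsScalarNaturalAt k n v hn)
    (fun k => (S.LD k).fs) u w hwu hrel hcompat κ.κ κ.ks κ.κ_red κ.one κ.one_mem κ.κ_one
  have hconc : St.Conclusion hyt κt.one :=
    h p K R N Rk Nbar Nq St κt hyt pins hP htame hp0 hu hL (hκone ▸ hone)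
  rw [hκone] at hconc
  exact (S.conclusion_with_fs_iff (fun k => tameSlotOn pins (S.LD k).ρq (fun n v => n ∈ levels S.L ∧ v ∈ n) (hP k))
    hy hyt κ.one).1 hconc

/-! ## §2 F-161′ from full, tame-pinned settings -/

/-- **F-161′ from Thm. 1.6.1 on FULL (`e_i = i + 1`), TAME-PINNED settings**, the per-setting hypothesis carrying the two
guards: §1 composed with the `π`-adic refinement and the cofinal transfer (`conclusion_of_full_of_tame` — the refined
setting `S.refine` has the same `p`, `K`, `R`, so the guards are passed on unchanged).
[cite: Howard2004HeegnerKolyvagin, Thm. 1.6.1 and its proof (arXiv Thm. 2.6.1, p. 11 L23–28, L33–47; p. 12 L29–55), Rem. 1.3.1 (p. 7 L125–127)] -/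
theorem thm161_printIntended_of_full_tame
    (h : ∀ (p : ℕ) [Fact p.Prime] (K : Type) [Field K] [NumberField K]
      (R : Type) [CommRing R] [IsDomain R] [IsDiscreteValuationRing R] [Algebra ℤ_[p] R]
      (N : ℕ → Type) [∀ k, AddCommGroup (N k)] [∀ k, TopologicalSpace (N k)]
      [∀ k, DiscreteTopology (N k)] [∀ k, Module R (N k)]
      (Rk : ℕ → Type) [∀ k, CommRing (Rk k)] [∀ k, IsLocalRing (Rk k)] [∀ k, TopologicalSpace (Rk k)]
      [∀ k, DiscreteTopology (Rk k)] [∀ k, Algebra ℤ_[p] (Rk k)] [∀ k, Algebra R (Rk k)]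
      [∀ k, Module (Rk k) (N k)] [∀ k, IsScalarTower R (Rk k) (N k)]
      (Nbar : Type) [AddCommGroup Nbar] [TopologicalSpace Nbar] [DiscreteTopology Nbar]
      [∀ k, Module (Rk k) Nbar]
      (Nq : ℕ → Finset (HeightOneSpectrum (𝓞 K)) → Type) [∀ k n, AddCommGroup (Nq k n)]
      [∀ k n, TopologicalSpace (Nq k n)] [∀ k n, DiscreteTopology (Nq k n)]
      [∀ k n, Module (Rk k) (Nq k n)] [∀ k n, Module R (Nq k n)]
      [∀ k n, IsScalarTower R (Rk k) (Nq k n)] [∀ k n, Finite (Nq k n)]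
      (S : DVRSetting p K R N Rk Nbar Nq) (κ : S.KolyvaginSystem) (hy : S.SatisfiesH)
      (pins : ∀ v : HeightOneSpectrum (𝓞 K), TamePin v)
      (hP : ∀ k n v, n ∈ levels S.L ∧ v ∈ n → TameHyp (S.LD k).ρq n v),
      (∀ i, S.e i = i + 1) →
      (∀ k, (S.LD k).fs = tameSlotOn pins (S.LD k).ρq (fun n v => n ∈ levels S.L ∧ v ∈ n) (hP k)) →
      ((p : ℕ) : R) ≠ 0 → ¬ p ∣ Nat.card (𝓞 K)ˣ →
      S.LargePrimes → κ.one ≠ 0 → S.Conclusion hy κ.one) :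
    thm161_dvrKolyvaginBound_printIntended := by
  refine thm161_printIntended_of_forall_tame ?_
  intro p _ K _ _ R _ _ _ _ N _ _ _ _ Rk _ _ _ _ _ _ _ _ Nbar _ _ _ _ Nq _ _ _ _ _ _ _ S κ hy pins hP htame hp0 hu hL hone
  exact S.conclusion_of_full_of_tame hy pins hP htame κ hL hone
    (fun N' _ _ _ _ Rk' _ _ _ _ _ _ _ _ Nbar' _ _ _ _ Nq' _ _ _ _ _ _ _ S' κ' hy' pins' hP' hfull' htame' hL' hone' =>
      h p K R N' Rk' Nbar' Nq' S' κ' hy' pins' hP' hfull' htame' hp0 hu hL' hone')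

/-! ## §3 F-161′ from the five remaining engine inputs -/

/-- **F-161′ from ONE hypothesis: on every FULL, TAME-PINNED setting with H.0–H.5, `(p : R) ≠ 0`, `p ∤ #𝓞_K^×`,
`𝓛_s ⊂ 𝓛` and `κ_1 ≠ 0`, the levelwise structure and eigen-counts with the five remaining engine inputs `hlam`, `h159`,
`hsmall`, `hchebI`, `hchebII`** — the F-161′ twin of `thm161_of_engineInputs_full` (§2 then `conclusion_of_engineInputs_full`).
[cite: Howard2004HeegnerKolyvagin, Thm. 1.6.1 and Lemma 1.6.4 (arXiv Thm. 2.6.1, p. 11 L23–47; Lemma 2.6.4, p. 11 L82 – p. 12 L55)] -/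
theorem thm161_printIntended_of_engineInputs_full
    (h : ∀ (p : ℕ) [Fact p.Prime] (K : Type) [Field K] [NumberField K]
      (R : Type) [CommRing R] [IsDomain R] [IsDiscreteValuationRing R] [Algebra ℤ_[p] R]
      (N : ℕ → Type) [∀ k, AddCommGroup (N k)] [∀ k, TopologicalSpace (N k)]
      [∀ k, DiscreteTopology (N k)] [∀ k, Module R (N k)]
      (Rk : ℕ → Type) [∀ k, CommRing (Rk k)] [∀ k, IsLocalRing (Rk k)] [∀ k, TopologicalSpace (Rk k)]
      [∀ k, DiscreteTopology (Rk k)] [∀ k, Algebra ℤ_[p] (Rk k)] [∀ k, Algebra R (Rk k)]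
      [∀ k, Module (Rk k) (N k)] [∀ k, IsScalarTower R (Rk k) (N k)]
      (Nbar : Type) [AddCommGroup Nbar] [TopologicalSpace Nbar] [DiscreteTopology Nbar]
      [∀ k, Module (Rk k) Nbar]
      (Nq : ℕ → Finset (HeightOneSpectrum (𝓞 K)) → Type) [∀ k n, AddCommGroup (Nq k n)]
      [∀ k n, TopologicalSpace (Nq k n)] [∀ k n, DiscreteTopology (Nq k n)]
      [∀ k n, Module (Rk k) (Nq k n)] [∀ k n, Module R (Nq k n)]
      [∀ k n, IsScalarTower R (Rk k) (Nq k n)] [∀ k n, Finite (Nq k n)]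
      (S : DVRSetting p K R N Rk Nbar Nq) (κ : S.KolyvaginSystem) (hy : S.SatisfiesH)
      (pins : ∀ v : HeightOneSpectrum (𝓞 K), TamePin v)
      (hP : ∀ k n v, n ∈ levels S.L ∧ v ∈ n → TameHyp (S.LD k).ρq n v),
      (∀ i, S.e i = i + 1) →
      (∀ k, (S.LD k).fs = tameSlotOn pins (S.LD k).ρq (fun n v => n ∈ levels S.L ∧ v ∈ n) (hP k)) →
      ((p : ℕ) : R) ≠ 0 → ¬ p ∣ Nat.card (𝓞 K)ˣ →
      S.LargePrimes → κ.one ≠ 0 →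
      letI : ∀ k, Module R (galoisCohomology (S.T.ρ k) 1) :=
        fun k => galoisCohomology.moduleH1 (S.T.ρ k) (S.T.hlin k)
      letI : ∀ (k : ℕ) (v : Place K), Module R (galoisCohomology ((S.T.ρ k).toLocal v) 1) :=
        fun k v => galoisCohomology.moduleH1 ((S.T.ρ k).toLocal v) ((S.T.hlin k).restrictField (Place.Completion v))
      ∃ (hdec : S.HasLevelDecompositions hy) (_ : S.HasLevelDecompositionsAt hy)
        (ρp ρm : ℕ → Finset (HeightOneSpectrum (𝓞 K)) → ℕ),
        (∀ k n, ↑n ⊆ S.enginePrimes k → S.stub hy hdec k n ≠ ⊥ →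
          S.stub hy hdec k n = ⊤ ∨
            (S.stubLength hy hdec k n - 1 < k ∧ S.stub hy hdec (S.stubLength hy hdec k n - 1) n = ⊥)) ∧
        (∀ k n (ℓ : HeightOneSpectrum (𝓞 K)), ↑n ⊆ S.enginePrimes k → ℓ ∈ S.enginePrimes k → ℓ ∉ n →
          S.stub hy hdec k n ≤ LinearMap.ker ((S.locR k (Sum.inr ℓ)).domRestrict (S.selmerModuleAt hy k n)) →
            S.stub hy hdec k (insert ℓ n) ≤
              LinearMap.ker ((S.locR k (Sum.inr ℓ)).domRestrict (S.selmerModuleAt hy k (insert ℓ n)))) ∧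
        (∀ k n, ↑n ⊆ S.enginePrimes k → ρp k n + ρm k n ≤ 1 → S.stub hy hdec k n = ⊤) ∧
        (∀ k n, ↑n ⊆ S.enginePrimes k → 0 < ρp k n → 0 < ρm k n → ∀ d : ↥(S.selmerModuleAt hy k n), d ≠ 0 →
            S.π • d = 0 → ∃ ℓ ∈ S.enginePrimes k, ℓ ∉ n ∧
              (S.locR k (Sum.inr ℓ)).domRestrict (S.selmerModuleAt hy k n) d ≠ 0 ∧
                ρp k (insert ℓ n) + 1 = ρp k n ∧ ρm k (insert ℓ n) + 1 = ρm k n) ∧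
        (∀ k n, ↑n ⊆ S.enginePrimes k → (ρm k n = 0 ∧ 2 ≤ ρp k n) ∨ (ρp k n = 0 ∧ 2 ≤ ρm k n) →
            ∀ d : ↥(S.selmerModuleAt hy k n), d ≠ 0 → S.π • d = 0 →
              ∃ ℓ ∈ S.enginePrimes k, ℓ ∉ n ∧ (S.locR k (Sum.inr ℓ)).domRestrict (S.selmerModuleAt hy k n) d ≠ 0 ∧
                0 < ρp k (insert ℓ n) ∧ 0 < ρm k (insert ℓ n) ∧
                  ρp k (insert ℓ n) + ρm k (insert ℓ n) = ρp k n + ρm k n)) :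
    thm161_dvrKolyvaginBound_printIntended := by
  refine thm161_printIntended_of_full_tame ?_
  intro p _ K _ _ R _ _ _ _ N _ _ _ _ Rk _ _ _ _ _ _ _ _ Nbar _ _ _ _ Nq _ _ _ _ _ _ _ S κ hy pins hP hfull htame hp0 hu hL hone
  obtain ⟨hdec, hdecAt, ρp, ρm, hlam, h159, hsmall, hchebI, hchebII⟩ :=
    h p K R N Rk Nbar Nq S κ hy pins hP hfull htame hp0 hu hL hone
  exact S.conclusion_of_engineInputs_full hy κ pins hdec hdecAt hfull ρp ρm hlam h159 hsmall hchebI hchebII hone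

/-! ## §4 F-161′ from `h159` and `hcheb` (and the print leaf C45.1′) -/

/-- **F-161′ from TWO remaining inputs** — on every full, tame-pinned setting with H.0–H.5, `(p : R) ≠ 0`,
`p ∤ #𝓞_K^×`, `𝓛_s ⊂ 𝓛`, `κ_1 ≠ 0`: the levelwise structure, `h159`, and `hchebI ∧ hchebII` for every pair of
ℕ-letters reading the eigen-lengths — the F-161′ twin of `thm161_of_h159_hcheb` (§3 with `ρp ρm := exists_eigenLengths`,
`hsmall := hsmall_of_eigenLengths`, `hlam := engine_hlam`).
[cite: Howard2004HeegnerKolyvagin, Thm. 1.6.1, Lemma 1.3.3, Lemma 1.5.3, Def. 1.5.4, Lemma 1.6.2, Lemma 1.6.4 (arXiv p. 8 L1–30; p. 10 L40–60; p. 11 L23–58; p. 11 L82 – p. 12 L55)] -/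
theorem thm161_printIntended_of_h159_hcheb
    (h : ∀ (p : ℕ) [Fact p.Prime] (K : Type) [Field K] [NumberField K]
      (R : Type) [CommRing R] [IsDomain R] [IsDiscreteValuationRing R] [Algebra ℤ_[p] R]
      (N : ℕ → Type) [∀ k, AddCommGroup (N k)] [∀ k, TopologicalSpace (N k)]
      [∀ k, DiscreteTopology (N k)] [∀ k, Module R (N k)]
      (Rk : ℕ → Type) [∀ k, CommRing (Rk k)] [∀ k, IsLocalRing (Rk k)] [∀ k, TopologicalSpace (Rk k)]
      [∀ k, DiscreteTopology (Rk k)] [∀ k, Algebra ℤ_[p] (Rk k)] [∀ k, Algebra R (Rk k)]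
      [∀ k, Module (Rk k) (N k)] [∀ k, IsScalarTower R (Rk k) (N k)]
      (Nbar : Type) [AddCommGroup Nbar] [TopologicalSpace Nbar] [DiscreteTopology Nbar]
      [∀ k, Module (Rk k) Nbar]
      (Nq : ℕ → Finset (HeightOneSpectrum (𝓞 K)) → Type) [∀ k n, AddCommGroup (Nq k n)]
      [∀ k n, TopologicalSpace (Nq k n)] [∀ k n, DiscreteTopology (Nq k n)]
      [∀ k n, Module (Rk k) (Nq k n)] [∀ k n, Module R (Nq k n)]
      [∀ k n, IsScalarTower R (Rk k) (Nq k n)] [∀ k n, Finite (Nq k n)]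
      (S : DVRSetting p K R N Rk Nbar Nq) (κ : S.KolyvaginSystem) (hy : S.SatisfiesH)
      (pins : ∀ v : HeightOneSpectrum (𝓞 K), TamePin v)
      (hP : ∀ k n v, n ∈ levels S.L ∧ v ∈ n → TameHyp (S.LD k).ρq n v),
      (∀ i, S.e i = i + 1) →
      (∀ k, (S.LD k).fs = tameSlotOn pins (S.LD k).ρq (fun n v => n ∈ levels S.L ∧ v ∈ n) (hP k)) →
      ((p : ℕ) : R) ≠ 0 → ¬ p ∣ Nat.card (𝓞 K)ˣ →
      S.LargePrimes → κ.one ≠ 0 →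
      letI : ∀ k, Module R (galoisCohomology (S.T.ρ k) 1) :=
        fun k => galoisCohomology.moduleH1 (S.T.ρ k) (S.T.hlin k)
      letI : ∀ (k : ℕ) (v : Place K), Module R (galoisCohomology ((S.T.ρ k).toLocal v) 1) :=
        fun k v => galoisCohomology.moduleH1 ((S.T.ρ k).toLocal v) ((S.T.hlin k).restrictField (Place.Completion v))
      ∃ (hdec : S.HasLevelDecompositions hy) (_ : S.HasLevelDecompositionsAt hy),
        (∀ k n (ℓ : HeightOneSpectrum (𝓞 K)), ↑n ⊆ S.enginePrimes k → ℓ ∈ S.enginePrimes k → ℓ ∉ n →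
          S.stub hy hdec k n ≤ LinearMap.ker ((S.locR k (Sum.inr ℓ)).domRestrict (S.selmerModuleAt hy k n)) →
            S.stub hy hdec k (insert ℓ n) ≤
              LinearMap.ker ((S.locR k (Sum.inr ℓ)).domRestrict (S.selmerModuleAt hy k (insert ℓ n)))) ∧
        (∀ ρp ρm : ℕ → Finset (HeightOneSpectrum (𝓞 K)) → ℕ,
          (∀ (k : ℕ) (n : Finset (HeightOneSpectrum (𝓞 K))), ↑n ⊆ S.enginePrimes k →
            letI := galoisCohomology.moduleH1 S.ρbar (S.isScalarLinear_rhobar hy k)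
            (ρp k n : ℕ∞) = Module.length (Rk k) ↥(galoisCohomology.submoduleOfStable (S.isScalarLinear_rhobar hy k)
              ((((hy.h1 k).1.propagateStructure (S.t k).cond).modify (transverseStructure p S.ρbar S.jbar)
                  ∅ ∅ n).selmerGroup ⊓
                (semilinearH S.cd.isLift (S.A k).θ.toAddMonoidHom (S.A k).isSemilinear 1 - AddMonoidHom.id _).ker)
              (S.scalarMapH1_mem_residualSelmer_inf_ker_sub hy k ∅ ∅ n))) →
          (∀ (k : ℕ) (n : Finset (HeightOneSpectrum (𝓞 K))), ↑n ⊆ S.enginePrimes k →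
            letI := galoisCohomology.moduleH1 S.ρbar (S.isScalarLinear_rhobar hy k)
            (ρm k n : ℕ∞) = Module.length (Rk k) ↥(galoisCohomology.submoduleOfStable (S.isScalarLinear_rhobar hy k)
              ((((hy.h1 k).1.propagateStructure (S.t k).cond).modify (transverseStructure p S.ρbar S.jbar)
                  ∅ ∅ n).selmerGroup ⊓
                (semilinearH S.cd.isLift (S.A k).θ.toAddMonoidHom (S.A k).isSemilinear 1 + AddMonoidHom.id _).ker)
              (S.scalarMapH1_mem_residualSelmer_inf_ker_add hy k ∅ ∅ n))) →
          (∀ k n, ↑n ⊆ S.enginePrimes k → 0 < ρp k n → 0 < ρm k n → ∀ d : ↥(S.selmerModuleAt hy k n), d ≠ 0 →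
            S.π • d = 0 → ∃ ℓ ∈ S.enginePrimes k, ℓ ∉ n ∧
              (S.locR k (Sum.inr ℓ)).domRestrict (S.selmerModuleAt hy k n) d ≠ 0 ∧
                ρp k (insert ℓ n) + 1 = ρp k n ∧ ρm k (insert ℓ n) + 1 = ρm k n) ∧
          (∀ k n, ↑n ⊆ S.enginePrimes k → (ρm k n = 0 ∧ 2 ≤ ρp k n) ∨ (ρp k n = 0 ∧ 2 ≤ ρm k n) →
            ∀ d : ↥(S.selmerModuleAt hy k n), d ≠ 0 → S.π • d = 0 →
              ∃ ℓ ∈ S.enginePrimes k, ℓ ∉ n ∧ (S.locR k (Sum.inr ℓ)).domRestrict (S.selmerModuleAt hy k n) d ≠ 0 ∧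
                0 < ρp k (insert ℓ n) ∧ 0 < ρm k (insert ℓ n) ∧
                  ρp k (insert ℓ n) + ρm k (insert ℓ n) = ρp k n + ρm k n))) :
    thm161_dvrKolyvaginBound_printIntended := by
  refine thm161_printIntended_of_engineInputs_full ?_
  intro p _ K _ _ R _ _ _ _ N _ _ _ _ Rk _ _ _ _ _ _ _ _ Nbar _ _ _ _ Nq _ _ _ _ _ _ _ S κ hy pins hP hfull htame hp0 hu hL hone
  obtain ⟨hdec, hdecAt, h159, hcheb⟩ := h p K R N Rk Nbar Nq S κ hy pins hP hfull htame hp0 hu hL hone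
  obtain ⟨ρp, ρm, hρp, hρm⟩ := S.exists_eigenLengths hy hdec
  obtain ⟨hchebI, hchebII⟩ := hcheb ρp ρm hρp hρm
  exact ⟨hdec, hdecAt, ρp, ρm, S.engine_hlam hy hfull hdec, h159, S.hsmall_of_eigenLengths hy hdec ρp ρm hρp hρm,
    hchebI, hchebII⟩

/-- **F-161′ from the print leaf C45.1′ (`prop141_casselsTate_skewPairing_atLevel`) and the TWO remaining engine
inputs** `h159` (at the leaf's decompositions `hasLevelDecompositions_of_prop141`) and `hchebI ∧ hchebII`, per full
tame-pinned setting with H.0–H.5, `(p : R) ≠ 0`, `p ∤ #𝓞_K^×`, `𝓛_s ⊂ 𝓛`, `κ_1 ≠ 0` — the F-161′ twin of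
`thm161_of_prop141_h159_hcheb`, the by-name target of the cell's closing term «Thm161OfEngineBricks».
Neither F-161 nor F-161′ is proved here (the two inputs remain hypotheses; C45.1′ is a hypothesis by name).
[cite: Howard2004HeegnerKolyvagin, Thm. 1.6.1, Prop. 1.4.1, Thm. 1.4.2, Lemma 1.6.4 (arXiv p. 8 L83–142; p. 11 L23–58; p. 11 L82 – p. 12 L55)] -/
theorem thm161_printIntended_of_prop141_h159_hcheb (h141 : prop141_casselsTate_skewPairing_atLevel)
    (h : ∀ (p : ℕ) [Fact p.Prime] (K : Type) [Field K] [NumberField K]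
      (R : Type) [CommRing R] [IsDomain R] [IsDiscreteValuationRing R] [Algebra ℤ_[p] R]
      (N : ℕ → Type) [∀ k, AddCommGroup (N k)] [∀ k, TopologicalSpace (N k)]
      [∀ k, DiscreteTopology (N k)] [∀ k, Module R (N k)]
      (Rk : ℕ → Type) [∀ k, CommRing (Rk k)] [∀ k, IsLocalRing (Rk k)] [∀ k, TopologicalSpace (Rk k)]
      [∀ k, DiscreteTopology (Rk k)] [∀ k, Algebra ℤ_[p] (Rk k)] [∀ k, Algebra R (Rk k)]
      [∀ k, Module (Rk k) (N k)] [∀ k, IsScalarTower R (Rk k) (N k)]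
      (Nbar : Type) [AddCommGroup Nbar] [TopologicalSpace Nbar] [DiscreteTopology Nbar]
      [∀ k, Module (Rk k) Nbar]
      (Nq : ℕ → Finset (HeightOneSpectrum (𝓞 K)) → Type) [∀ k n, AddCommGroup (Nq k n)]
      [∀ k n, TopologicalSpace (Nq k n)] [∀ k n, DiscreteTopology (Nq k n)]
      [∀ k n, Module (Rk k) (Nq k n)] [∀ k n, Module R (Nq k n)]
      [∀ k n, IsScalarTower R (Rk k) (Nq k n)] [∀ k n, Finite (Nq k n)]
      (S : DVRSetting p K R N Rk Nbar Nq) (κ : S.KolyvaginSystem) (hy : S.SatisfiesH)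
      (pins : ∀ v : HeightOneSpectrum (𝓞 K), TamePin v)
      (hP : ∀ k n v, n ∈ levels S.L ∧ v ∈ n → TameHyp (S.LD k).ρq n v),
      (∀ i, S.e i = i + 1) →
      (∀ k, (S.LD k).fs = tameSlotOn pins (S.LD k).ρq (fun n v => n ∈ levels S.L ∧ v ∈ n) (hP k)) →
      ((p : ℕ) : R) ≠ 0 → ¬ p ∣ Nat.card (𝓞 K)ˣ →
      S.LargePrimes → κ.one ≠ 0 →
      letI : ∀ k, Module R (galoisCohomology (S.T.ρ k) 1) :=
        fun k => galoisCohomology.moduleH1 (S.T.ρ k) (S.T.hlin k)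
      letI : ∀ (k : ℕ) (v : Place K), Module R (galoisCohomology ((S.T.ρ k).toLocal v) 1) :=
        fun k v => galoisCohomology.moduleH1 ((S.T.ρ k).toLocal v) ((S.T.hlin k).restrictField (Place.Completion v))
      (∀ k n (ℓ : HeightOneSpectrum (𝓞 K)), ↑n ⊆ S.enginePrimes k → ℓ ∈ S.enginePrimes k → ℓ ∉ n →
          S.stub hy (S.hasLevelDecompositions_of_prop141 h141 hy) k n ≤ LinearMap.ker ((S.locR k (Sum.inr ℓ)).domRestrict (S.selmerModuleAt hy k n)) →
            S.stub hy (S.hasLevelDecompositions_of_prop141 h141 hy) k (insert ℓ n) ≤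
              LinearMap.ker ((S.locR k (Sum.inr ℓ)).domRestrict (S.selmerModuleAt hy k (insert ℓ n)))) ∧
      (∀ ρp ρm : ℕ → Finset (HeightOneSpectrum (𝓞 K)) → ℕ,
        (∀ (k : ℕ) (n : Finset (HeightOneSpectrum (𝓞 K))), ↑n ⊆ S.enginePrimes k →
            letI := galoisCohomology.moduleH1 S.ρbar (S.isScalarLinear_rhobar hy k)
            (ρp k n : ℕ∞) = Module.length (Rk k) ↥(galoisCohomology.submoduleOfStable (S.isScalarLinear_rhobar hy k)
              ((((hy.h1 k).1.propagateStructure (S.t k).cond).modify (transverseStructure p S.ρbar S.jbar)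
                  ∅ ∅ n).selmerGroup ⊓
                (semilinearH S.cd.isLift (S.A k).θ.toAddMonoidHom (S.A k).isSemilinear 1 - AddMonoidHom.id _).ker)
              (S.scalarMapH1_mem_residualSelmer_inf_ker_sub hy k ∅ ∅ n))) →
        (∀ (k : ℕ) (n : Finset (HeightOneSpectrum (𝓞 K))), ↑n ⊆ S.enginePrimes k →
            letI := galoisCohomology.moduleH1 S.ρbar (S.isScalarLinear_rhobar hy k)
            (ρm k n : ℕ∞) = Module.length (Rk k) ↥(galoisCohomology.submoduleOfStable (S.isScalarLinear_rhobar hy k)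
              ((((hy.h1 k).1.propagateStructure (S.t k).cond).modify (transverseStructure p S.ρbar S.jbar)
                  ∅ ∅ n).selmerGroup ⊓
                (semilinearH S.cd.isLift (S.A k).θ.toAddMonoidHom (S.A k).isSemilinear 1 + AddMonoidHom.id _).ker)
              (S.scalarMapH1_mem_residualSelmer_inf_ker_add hy k ∅ ∅ n))) →
        (∀ k n, ↑n ⊆ S.enginePrimes k → 0 < ρp k n → 0 < ρm k n → ∀ d : ↥(S.selmerModuleAt hy k n), d ≠ 0 →
            S.π • d = 0 → ∃ ℓ ∈ S.enginePrimes k, ℓ ∉ n ∧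
              (S.locR k (Sum.inr ℓ)).domRestrict (S.selmerModuleAt hy k n) d ≠ 0 ∧
                ρp k (insert ℓ n) + 1 = ρp k n ∧ ρm k (insert ℓ n) + 1 = ρm k n) ∧
        (∀ k n, ↑n ⊆ S.enginePrimes k → (ρm k n = 0 ∧ 2 ≤ ρp k n) ∨ (ρp k n = 0 ∧ 2 ≤ ρm k n) →
            ∀ d : ↥(S.selmerModuleAt hy k n), d ≠ 0 → S.π • d = 0 →
              ∃ ℓ ∈ S.enginePrimes k, ℓ ∉ n ∧ (S.locR k (Sum.inr ℓ)).domRestrict (S.selmerModuleAt hy k n) d ≠ 0 ∧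
                0 < ρp k (insert ℓ n) ∧ 0 < ρm k (insert ℓ n) ∧
                  ρp k (insert ℓ n) + ρm k (insert ℓ n) = ρp k n + ρm k n))) :
    thm161_dvrKolyvaginBound_printIntended := by
  refine thm161_printIntended_of_h159_hcheb ?_
  intro p _ K _ _ R _ _ _ _ N _ _ _ _ Rk _ _ _ _ _ _ _ _ Nbar _ _ _ _ Nq _ _ _ _ _ _ _ S κ hy pins hP hfull htame hp0 hu hL hone
  obtain ⟨h159, hcheb⟩ := h p K R N Rk Nbar Nq S κ hy pins hP hfull htame hp0 hu hL hone
  exact ⟨S.hasLevelDecompositions_of_prop141 h141 hy, S.hasLevelDecompositionsAt_of_prop141 h141 hy, h159, hcheb⟩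

end DVRSetting

end Literature.NumberTheory.GaloisCohomology.Howard2004

end
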